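import Summits.BirchSwinnertonDyer.BirchSwinnertonDyer.Theorems.SignedLowerHalvesSmallImageLowerHalfBothSignsRttLayerLawDepleted
import HarnessLib

/-!
# Route `SignedLowerHalves`, crux L `SmallImageLowerHalfBothSigns` (item stmt-BirchSwinnertonDyer-23599), line `rtt_w3`,
# stub Kan₂ `stub_thetaLayerLambda_ns` — brick K5: UNIT CONTENT of the W-side depleted layer polynomial from
# `HasUnitContent (kobayashiL ε L⁺ L⁻)` (any prime `p`)

Width seat `bsd-line-slh-p3-w3` g11 under LEAD `cruxlead-stmt-BirchSwinnertonDyer-23599` g0 (cell `bsd-ssimc`). ROUTE-INDEPENDENT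
helper (`--supports stmt-BirchSwinnertonDyer-23599`); THEOREMS ONLY — no definition, no named fact, no `sorry`; closes nothing;
BSD is not proved by any of this.

WHY. Kan₂ compares the layer-`λ` of the W-side depleted polynomial `R_W = (θ_n(f)·∏_{v∈S₀} E_{v,n}) mod ω_n` with the partner's
through Vatsal's canonical-period congruence; the comparison (`layerLambda_eq_of_supNorm_sub_C_mul_lt`) needs `R_W` to have a
UNIT coefficient, i.e. `‖R_W‖_sup = 1`. The tree's integral-model lemma `ResidualThetaLayer.exists_integralModel_of_isCongrModOmega`
writes `θ_n = p^μ·P` with `μ` EXISTENTIAL (its proof takes `μ = μ(L)`); this file records the sharper form with the exponent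
`μ(L) = X1.MuLambda.mu L` DISPLAYED (§1, the tree proof verbatim with the witness exposed), so that under the stub's hypothesis
`HasUnitContent (kobayashiL ε L⁺ L⁻)` (`μ(L^ε) = 0`, `TwoAdicTwistConverse.hasUnitContent_iff_mu_eq_zero`) the depleted polynomial
is the image of an integral polynomial with a unit coefficient (§2) and has sup norm `1` at every large layer of the parity of `ε` (§3).

* §1 `exists_integralModel_of_isCongrModOmega_mu` — `θ = p^{μ(L)}·P`, `ord_X(P̄) = d + λ(L)` (exponent displayed).
* §2 `exists_integralModel_depleted_of_mu_eq_zero` — for `μ(L) = 0`: `R_W = R^φ` with `R ∈ ℤ_p[X]`, `ord_X(R̄) = d + λ(L) + Σδ`.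
* §3 `supNorm_depleted_eq_one_of_isPollackPair`, `eventually_supNorm_depleted_eq_one_of_isPollackPair` — `‖R_W‖_sup = 1` (and
  `λ_n(R_W) = deg ω_n^{−ε} + λ(L^ε) + Σδ`) at the layers of the parity of `ε`, under `HasUnitContent (kobayashiL ε L⁺ L⁻)`.

References: [Pollack2003] Prop. 6.18, Prop. 6.9; [PollackWeston2011MT] §3.1, Thm. 4.1; [GreenbergVatsal2000] §2 Prop. (2.4);
[Washington1997] §7.1.
-/

set_option autoImplicit false
-- D-0017: single-problem summit, the namespace repeats the problem name by design.
set_option linter.dupNamespace false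
noncomputable section

open scoped Classical MatrixGroups ModularForm BigOperators

open CongruenceSubgroup WeierstrassCurve Polynomial NumberField IsDedekindDomain
  Literature.NumberTheory.EllipticCurves Literature.NumberTheory.EllipticCurves.ModularForms
  Literature.NumberTheory.EllipticCurves.GreenbergVatsal2000
  Literature.NumberTheory.IwasawaTheory Rat.HeightOneSpectrum
  Summit.BirchSwinnertonDyer.Rank1Residual.Supersingular
  Summit.BirchSwinnertonDyer.Rank1Residual.X1.MuLambda
  Summit.BirchSwinnertonDyer.Rank1Residual.X2.GreenbergVatsalAnalyticTransferCore
  Summit.BirchSwinnertonDyer.Rank1Residual.X2.EulerFactorInvariants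
  Summit.BirchSwinnertonDyer.BirchSwinnertonDyer.Theorems.ResidualThetaLayer
  Summit.BirchSwinnertonDyer.BirchSwinnertonDyer.Theorems.SmallImageRttOneSided
  Summit.BirchSwinnertonDyer.BirchSwinnertonDyer.Theorems.TwoAdicTwistConverse

namespace Summit.BirchSwinnertonDyer.BirchSwinnertonDyer.Theorems.SmallImageRttKan

/-! ## §1 The integral model with the exponent `μ(L)` displayed -/

section Model

variable {p : ℕ} [hp : Fact p.Prime]

/-- **Integral model of a layer element from a Pollack congruence, exponent displayed.** Same hypotheses as the tree's
`ResidualThetaLayer.exists_integralModel_of_isCongrModOmega` (`θ ≡ ω·L (mod ω_n)` in `Λ ⊗ ℚ_p`, `θ_j = 0` for `j ≥ pⁿ`,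
`ω̄ = u·X^d`, `u ≠ 0`, `L ≠ 0`, `d + λ(L) < pⁿ`); conclusion `θ = p^{μ(L)}·P` with `μ(L) = X1.MuLambda.mu L` and `ord_X(P̄) = d + λ(L)`
(the tree proof verbatim, with its witness `μ = μ(L)` exposed — adapted from `…ResidualThetaMainConjectureAtTwoMazurTateLayer`).
[cite: Pollack2003, Prop. 6.18 and Prop. 6.9] [cite: PollackWeston2011MT, §3.1 and §4] -/
theorem exists_integralModel_of_isCongrModOmega_mu {n : ℕ} {θ : ℚ[X]} {ω : ℤ[X]}
    {L : IwasawaAlgebra p} {u : ZMod p} {d : ℕ} (hcong : IsCongrModOmega p n θ ω L) (hL : L ≠ 0)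
    (hθ : ∀ j, p ^ n ≤ j → θ.coeff j = 0) (hω : ω.map (Int.castRingHom (ZMod p)) = C u * X ^ d)
    (hu : u ≠ 0) (hd : d + lam L < p ^ n) :
    ∃ P : ℤ_[p][X],
      θ.map (algebraMap ℚ ℚ_[p]) = C ((p : ℚ_[p]) ^ mu L) * P.map (algebraMap ℤ_[p] ℚ_[p]) ∧
      ((P.map (PadicInt.toZMod (p := p)) : (ZMod p)[X]) : PowerSeries (ZMod p)).order =
        ((d + lam L : ℕ) : ℕ∞) := by
  -- adapted from ResidualThetaTransportAtTwoResidualThetaMainConjectureAtTwoMazurTateLayer (exists_integralModel_of_isCongrModOmega)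
  obtain ⟨m, q, hmq⟩ := hcong
  set ωΛ : IwasawaAlgebra p := ((ω.map (Int.castRingHom ℤ_[p]) : ℤ_[p][X]) : PowerSeries ℤ_[p])
    with hωΛ
  set ωn : IwasawaAlgebra p :=
    (((cyclotomicOmega p n).map (Int.castRingHom ℤ_[p]) : ℤ_[p][X]) : PowerSeries ℤ_[p]) with hωn
  set θ' : PowerSeries ℚ_[p] := ((θ.map (algebraMap ℚ ℚ_[p]) : ℚ_[p][X]) : PowerSeries ℚ_[p])
    with hθ'
  have hp0 : (p : ℤ_[p]) ≠ 0 := by exact_mod_cast hp.out.ne_zero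
  set μ := mu L with hμ
  set L₀ := pfree L with hL₀def
  have hLfac : L = PowerSeries.C ((p : ℤ_[p]) ^ μ) * L₀ := eq_C_pow_mu_mul_pfree L
  have hL₀ : red L₀ ≠ 0 := red_pfree_ne_zero hL
  set M := m + μ with hM
  set Θ : IwasawaAlgebra p := PowerSeries.C ((p : ℤ_[p]) ^ M) * (ωΛ * L₀) + ωn * q with hΘ
  have hkey : PowerSeries.C ((p : ℤ_[p]) ^ M) * (ωΛ * L₀) =
      PowerSeries.C ((p : ℤ_[p]) ^ m) * (ωΛ * L) := by
    rw [hLfac, hM, pow_add, map_mul]; ring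
  have hιΘ : iwasawaToPowerSeries p Θ = PowerSeries.C ((p : ℚ_[p]) ^ m) * θ' := by
    have h1 := hmq
    rw [mul_sub, sub_eq_iff_eq_add] at h1
    rw [h1, hΘ, hkey, map_add, map_mul (iwasawaToPowerSeries p) (PowerSeries.C _), iwasawaToPowerSeries,
      PowerSeries.map_C, map_pow, map_natCast, add_comm]
  have hΘcoeff : ∀ j, p ^ n ≤ j → PowerSeries.coeff j Θ = 0 := by
    intro j hj
    have h1 : PowerSeries.coeff j (iwasawaToPowerSeries p Θ) = 0 := by
      rw [hιΘ, PowerSeries.coeff_C_mul, hθ', Polynomial.coeff_coe, Polynomial.coeff_map, hθ j hj, map_zero,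
        mul_zero]
    rw [iwasawaToPowerSeries, PowerSeries.coeff_map] at h1
    exact (IsFractionRing.injective ℤ_[p] ℚ_[p]) (by rw [h1, map_zero])
  have hbarω : PowerSeries.map (PadicInt.toZMod (p := p)) ωΛ = PowerSeries.C u * PowerSeries.X ^ d := by
    rw [hωΛ, map_coe_polynomial, Polynomial.map_map,
      RingHom.ext_int ((PadicInt.toZMod (p := p)).comp (Int.castRingHom ℤ_[p])) (Int.castRingHom (ZMod p)),
      hω, Polynomial.coe_mul, Polynomial.coe_C, Polynomial.coe_pow, Polynomial.coe_X]
  have hbarωn : PowerSeries.map (PadicInt.toZMod (p := p)) ωn = PowerSeries.X ^ p ^ n :=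
    map_toZMod_cyclotomicOmega n
  -- CLAIM A: `p^M ∣ q`
  have hq : ∃ q₁ : IwasawaAlgebra p, q = PowerSeries.C ((p : ℤ_[p]) ^ M) * q₁ := by
    by_cases hq0 : q = 0
    · exact ⟨0, by rw [hq0, mul_zero]⟩
    set k := mu q with hk
    set q₀ := pfree q with hq₀def
    have hqfac : q = PowerSeries.C ((p : ℤ_[p]) ^ k) * q₀ := eq_C_pow_mu_mul_pfree q
    have hq₀ : red q₀ ≠ 0 := red_pfree_ne_zero hq0
    by_cases hkM : M ≤ k
    · obtain ⟨e, he⟩ := Nat.exists_eq_add_of_le hkM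
      exact ⟨PowerSeries.C ((p : ℤ_[p]) ^ e) * q₀, by rw [hqfac, he, pow_add, map_mul, mul_assoc]⟩
    · exfalso
      obtain ⟨e, he⟩ := Nat.exists_eq_add_of_lt (not_le.mp hkM)
      set Θ' : IwasawaAlgebra p := PowerSeries.C ((p : ℤ_[p]) ^ (e + 1)) * (ωΛ * L₀) + ωn * q₀ with hΘ'
      have hΘfac : Θ = PowerSeries.C ((p : ℤ_[p]) ^ k) * Θ' := by
        rw [hΘ, hqfac, hΘ', he, show k + e + 1 = k + (e + 1) by ring, pow_add, map_mul]; ring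
      have hbar : PowerSeries.map (PadicInt.toZMod (p := p)) Θ' =
          PowerSeries.X ^ p ^ n * PowerSeries.map (PadicInt.toZMod (p := p)) q₀ := by
        rw [hΘ']
        simp only [map_add, map_mul]
        rw [map_toZMod_C_p_pow_succ, zero_mul, zero_add, hbarωn]
      have hq₀bar : PowerSeries.map (PadicInt.toZMod (p := p)) q₀ ≠ 0 := map_toZMod_ne_zero_of_red_ne_zero hq₀
      obtain ⟨i, hi⟩ : ∃ i, PowerSeries.coeff i (PowerSeries.map (PadicInt.toZMod (p := p)) q₀) ≠ 0 := by
        by_contra h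
        push Not at h
        exact hq₀bar (PowerSeries.ext fun j ↦ by rw [h j, map_zero])
      have h1 : PowerSeries.coeff (p ^ n + i) (PowerSeries.map (PadicInt.toZMod (p := p)) Θ') ≠ 0 := by
        rw [hbar, PowerSeries.coeff_X_pow_mul', if_pos (Nat.le_add_right _ _), Nat.add_sub_cancel_left]
        exact hi
      have h2 : PowerSeries.coeff (p ^ n + i) Θ' ≠ 0 := by
        intro h0
        apply h1
        rw [PowerSeries.coeff_map, h0, map_zero]
      have h3 : PowerSeries.coeff (p ^ n + i) Θ = 0 := hΘcoeff _ (Nat.le_add_right _ _)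
      rw [hΘfac, PowerSeries.coeff_C_mul, mul_eq_zero] at h3
      rcases h3 with h3 | h3
      · exact pow_ne_zero _ hp0 h3
      · exact h2 h3
  obtain ⟨q₁, hq₁⟩ := hq
  set Ψ : IwasawaAlgebra p := ωΛ * L₀ + ωn * q₁ with hΨ
  have hΘΨ : Θ = PowerSeries.C ((p : ℤ_[p]) ^ M) * Ψ := by rw [hΘ, hq₁, hΨ]; ring
  have hΨcoeff : ∀ j, p ^ n ≤ j → PowerSeries.coeff j Ψ = 0 := by
    intro j hj
    have h1 := hΘcoeff j hj
    rw [hΘΨ, PowerSeries.coeff_C_mul, mul_eq_zero] at h1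
    exact h1.resolve_left (pow_ne_zero _ hp0)
  have hbarΨ : ∀ j, j < p ^ n →
      PowerSeries.coeff j (PowerSeries.map (PadicInt.toZMod (p := p)) Ψ) =
        u * (if d ≤ j then PowerSeries.coeff (j - d) (PowerSeries.map (PadicInt.toZMod (p := p)) L₀) else 0) := by
    intro j hj
    rw [hΨ, map_add, map_mul, map_mul, hbarω, hbarωn, map_add, mul_assoc, PowerSeries.coeff_C_mul,
      PowerSeries.coeff_X_pow_mul', PowerSeries.coeff_X_pow_mul', if_neg (not_le.mpr hj), add_zero]
  have hlam := order_map_toZMod_pfree_eq_lam hL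
  rw [← hL₀def, PowerSeries.order_eq_nat] at hlam
  obtain ⟨hlamne, hlamlt⟩ := hlam
  set P : ℤ_[p][X] := PowerSeries.trunc (p ^ n) Ψ with hP
  have hPΨ : (P : PowerSeries ℤ_[p]) = Ψ := by
    ext j
    rw [Polynomial.coeff_coe, hP, PowerSeries.coeff_trunc]
    split_ifs with h
    · rfl
    · exact (hΨcoeff j (not_lt.mp h)).symm
  refine ⟨P, ?_, ?_⟩
  · have hθΨ : θ' = PowerSeries.C ((p : ℚ_[p]) ^ μ) * iwasawaToPowerSeries p Ψ := by
      have h1 : PowerSeries.C ((p : ℚ_[p]) ^ m) * θ' =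
          PowerSeries.C ((p : ℚ_[p]) ^ m) * (PowerSeries.C ((p : ℚ_[p]) ^ μ) * iwasawaToPowerSeries p Ψ) := by
        rw [← hιΘ, hΘΨ, map_mul, iwasawaToPowerSeries, PowerSeries.map_C, map_pow, map_natCast, hM, pow_add,
          map_mul, mul_assoc]
      have hC : PowerSeries.C ((p : ℚ_[p]) ^ m) ≠ 0 := by
        rw [Ne, ← map_zero (PowerSeries.C (R := ℚ_[p])), PowerSeries.C_injective.eq_iff]
        exact pow_ne_zero _ (by exact_mod_cast hp.out.ne_zero)
      exact mul_left_cancel₀ hC h1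
    apply Polynomial.coe_inj.mp
    rw [Polynomial.coe_mul, Polynomial.coe_C, ← map_coe_polynomial (algebraMap ℤ_[p] ℚ_[p]) P, hPΨ, ← hθ',
      hθΨ]
  · rw [PowerSeries.order_eq_nat]
    refine ⟨?_, fun i hi ↦ ?_⟩
    · rw [Polynomial.coeff_coe, Polynomial.coeff_map, hP, PowerSeries.coeff_trunc, if_pos hd,
        ← PowerSeries.coeff_map, hbarΨ _ hd, if_pos (Nat.le_add_right d _), Nat.add_sub_cancel_left]
      exact mul_ne_zero hu hlamne
    · rw [Polynomial.coeff_coe, Polynomial.coeff_map, hP, PowerSeries.coeff_trunc, if_pos (hi.trans hd),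
        ← PowerSeries.coeff_map, hbarΨ _ (hi.trans hd)]
      split_ifs with hdi
      · rw [hlamlt (i - d) (by omega), mul_zero]
      · rw [mul_zero]

end Model

/-! ## §2 The depleted layer polynomial is the image of an integral polynomial with a unit coefficient (`μ(L) = 0`) -/

section Depleted

variable (W : WeierstrassCurve ℚ) {p : ℕ} [hp : Fact p.Prime]

/-- **Integral model of the DEPLETED layer polynomial when `μ(L) = 0`** (odd `p`). Under the hypotheses of
`SmallImageRttLayerLaw.layerLambda_depleted_of_isCongrModOmega` (congruence `θ_n(f) ≡ (−1)^e ω L (mod ω_n)`, `ω̄ = X^d`, `L ≠ 0`,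
places `≠ p`, Frobenius thresholds, headroom `d + λ(L) + Σδ < pⁿ`) and `μ(L) = 0`, the W-side depleted layer polynomial
`R_W = (θ_n(f)·∏_{v∈S₀} E_{v,n}) mod ω_n ∈ ℚ̄_p[X]` is `R^φ` for the norm-preserving `φ : ℤ_p → ℚ̄_p` and an `R ∈ ℤ_p[X]` with
`ord_X(R̄) = d + λ(L) + Σ_{v∈S₀} δ_W^{(v)}`. [cite: Pollack2003, Prop. 6.18] [cite: GreenbergVatsal2000, §2 Prop. (2.4) and §1 (9)] -/
theorem exists_integralModel_depleted_of_mu_eq_zero (hp2 : p ≠ 2) {N : ℕ} (f : CuspForm (Gamma0 N) 2)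
    {n : ℕ} {ω : ℤ[X]} {d : ℕ} (hω : ω.map (Int.castRingHom (ZMod p)) = X ^ d) (e : ℕ)
    {L : IwasawaAlgebra p} (hL : L ≠ 0) (hμ : mu L = 0)
    (hcong : IsCongrModOmega p n (mazurTateElement f p n) ((-1) ^ e * ω) L)
    (S₀ : Finset (HeightOneSpectrum (𝓞 ℚ))) (hS : ∀ v ∈ S₀, natGenerator v ≠ p)
    (hfrob : ∀ v ∈ S₀, (frobeniusExponent p (natGenerator v : ℤ_[p])).valuation < n)
    (hroom : d + lam L + ∑ v ∈ S₀, delta W p v < p ^ n) :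
    ∃ R : ℤ_[p][X],
      ((mazurTateElement f p n).map (algebraMap ℚ (PadicAlgCl p)) *
          ∏ v ∈ S₀, ((W.localPolynomialAt v).map (Int.castRingHom (PadicAlgCl p))).comp
            (C ((natGenerator v : PadicAlgCl p)⁻¹) *
              (X + 1) ^ (PadicInt.toZModPow n (-(frobeniusExponent p (natGenerator v : ℤ_[p])))).val)) %ₘ
          ((X + 1) ^ p ^ n - 1) =
        R.map ((algebraMap ℚ_[p] (PadicAlgCl p)).comp (algebraMap ℤ_[p] ℚ_[p])) ∧
      ((R.map (PadicInt.toZMod (p := p)) : (ZMod p)[X]) : PowerSeries (ZMod p)).order =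
        ((d + lam L + ∑ v ∈ S₀, delta W p v : ℕ) : ℕ∞) := by
  -- adapted from my `SmallImageRttLayerLaw.layerLambda_depleted_of_isCongrModOmega` (p744056), with `μ = μ(L) = 0`
  set φ : ℤ_[p] →+* PadicAlgCl p := (algebraMap ℚ_[p] (PadicAlgCl p)).comp (algebraMap ℤ_[p] ℚ_[p])
    with hφdef
  set Sδ : ℕ := ∑ v ∈ S₀, delta W p v with hSδ
  have hn0 : 0 < p ^ n := pow_pos hp.out.pos n
  have hωu := map_zmod_neg_one_pow_mul hω e
  have hu : ((-1 : ZMod p) ^ e) ≠ 0 := pow_ne_zero _ (neg_ne_zero.mpr one_ne_zero)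
  have hθcoeff : ∀ i, p ^ n ≤ i → (mazurTateElement f p n).coeff i = 0 := fun i hi ↦
    coeff_eq_zero_of_natDegree_lt (lt_of_lt_of_le (natDegree_mazurTateElement_lt f p n) hi)
  have hd' : d + lam L < p ^ n := by omega
  obtain ⟨P, hθP, hordP⟩ := exists_integralModel_of_isCongrModOmega_mu hcong hL hθcoeff hωu hu hd'
  rw [hμ, pow_zero, C_1, one_mul] at hθP
  have hordE := order_layerEulerProduct W hp2 S₀ hS hfrob
  set E : HeightOneSpectrum (𝓞 ℚ) → ℤ_[p][X] := fun v ↦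
    ((W.localPolynomialAt v).map (Int.castRingHom ℤ_[p])).comp
      (C ((natGenerator v : ℤ_[p]).inv) *
        (X + 1) ^ (PadicInt.toZModPow n (-(frobeniusExponent p (natGenerator v : ℤ_[p])))).val) with hE
  set PP : ℤ_[p][X] := P * ∏ v ∈ S₀, E v with hPP
  have hordPP : ((PP.map (PadicInt.toZMod (p := p)) : (ZMod p)[X]) : PowerSeries (ZMod p)).order =
      ((d + lam L + Sδ : ℕ) : ℕ∞) := by
    rw [hPP, Polynomial.map_mul, Polynomial.coe_mul, PowerSeries.order_mul, hordP, hordE, ← Nat.cast_add]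
  set ωZ : ℤ_[p][X] := (X + 1) ^ p ^ n - 1 with hωZ
  have hωZmonic : ωZ.Monic := by
    have h1 : (X + 1 : ℤ_[p][X]).Monic := by rw [← C_1]; exact monic_X_add_C 1
    have hm : ((X + 1 : ℤ_[p][X]) ^ p ^ n).Monic := h1.pow _
    refine hm.sub_of_left ?_
    have hdeg : (X + 1 : ℤ_[p][X]).natDegree = 1 := by rw [← C_1, natDegree_X_add_C]
    rw [degree_one, degree_eq_natDegree hm.ne_zero, h1.natDegree_pow, hdeg, mul_one]
    exact_mod_cast hn0
  set R : ℤ_[p][X] := PP %ₘ ωZ with hR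
  have hordR : ((R.map (PadicInt.toZMod (p := p)) : (ZMod p)[X]) : PowerSeries (ZMod p)).order =
      ((d + lam L + Sδ : ℕ) : ℕ∞) := by
    rw [hR, Polynomial.map_modByMonic _ hωZmonic, hωZ, Polynomial.map_sub, Polynomial.map_pow,
      Polynomial.map_add, Polynomial.map_X, Polynomial.map_one, X_add_one_pow_prime_pow_sub_one p n]
    exact order_coe_modByMonic_X_pow _ hordPP (by omega)
  have hφint : φ.comp (Int.castRingHom ℤ_[p]) = Int.castRingHom (PadicAlgCl p) := RingHom.ext_int _ _
  have hφrat : (algebraMap ℚ_[p] (PadicAlgCl p)).comp (algebraMap ℚ ℚ_[p]) = algebraMap ℚ (PadicAlgCl p) :=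
    RingHom.ext_rat _ _
  have hφinv : ∀ v ∈ S₀, φ ((natGenerator v : ℤ_[p]).inv) = ((natGenerator v : PadicAlgCl p))⁻¹ := by
    intro v hv
    obtain ⟨hcop, -⟩ := coprime_natGenerator v (p := p) (hS v hv)
    have hnorm : ‖(natGenerator v : ℤ_[p])‖ = 1 := PadicInt.norm_natCast_eq_one_iff.mpr hcop
    have hmul : φ (natGenerator v : ℤ_[p]) * φ ((natGenerator v : ℤ_[p]).inv) = 1 := by
      rw [← map_mul, PadicInt.mul_inv hnorm, map_one]
    rw [map_natCast] at hmul
    exact eq_inv_of_mul_eq_one_right hmul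
  have hEmap : ∀ v ∈ S₀, (E v).map φ =
      ((W.localPolynomialAt v).map (Int.castRingHom (PadicAlgCl p))).comp
        (C ((natGenerator v : PadicAlgCl p)⁻¹) *
          (X + 1) ^ (PadicInt.toZModPow n (-(frobeniusExponent p (natGenerator v : ℤ_[p])))).val) := by
    intro v hv
    rw [hE, Polynomial.map_comp, Polynomial.map_map, hφint, Polynomial.map_mul, Polynomial.map_C, hφinv v hv,
      Polynomial.map_pow, Polynomial.map_add, Polynomial.map_X, Polynomial.map_one]
  have hθmap : (mazurTateElement f p n).map (algebraMap ℚ (PadicAlgCl p)) = P.map φ := by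
    rw [← hφrat, ← Polynomial.map_map, hθP, Polynomial.map_map]
  refine ⟨R, ?_, hordR⟩
  have hprod : ∏ v ∈ S₀, ((W.localPolynomialAt v).map (Int.castRingHom (PadicAlgCl p))).comp
        (C ((natGenerator v : PadicAlgCl p)⁻¹) *
          (X + 1) ^ (PadicInt.toZModPow n (-(frobeniusExponent p (natGenerator v : ℤ_[p])))).val) =
      (∏ v ∈ S₀, E v).map φ := by
    rw [Polynomial.map_prod]
    exact Finset.prod_congr rfl fun v hv ↦ (hEmap v hv).symm
  have hωmap : ((X + 1 : (PadicAlgCl p)[X]) ^ p ^ n - 1) = ωZ.map φ := by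
    rw [hωZ, Polynomial.map_sub, Polynomial.map_pow, Polynomial.map_add, Polynomial.map_X, Polynomial.map_one]
  rw [hθmap, hprod, ← Polynomial.map_mul, ← hPP, hωmap, ← Polynomial.map_modByMonic φ hωZmonic]

end Depleted

/-! ## §3 `‖R_W‖_sup = 1` at the layers of the parity of `ε`, under `HasUnitContent (kobayashiL ε L⁺ L⁻)` -/

section Pollack

variable (W : WeierstrassCurve ℚ) {p : ℕ} [hp : Fact p.Prime]

/-- **The W-side depleted layer polynomial has SUP NORM ONE (a unit coefficient) and the expected layer-`λ`**, at a layer `n`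
of the parity of `ε` past the Frobenius thresholds and inside the headroom, when the signed `p`-adic `L`-function of that sign has
unit content (`HasUnitContent (kobayashiL ε L⁺ L⁻)`, i.e. `μ(L^ε) = 0`): `‖R_W‖_sup = 1` and
`λ_n(R_W) = deg ω_n^{−ε} + λ(L^ε) + Σ_{v∈S₀} δ_W^{(v)}`. [cite: Pollack2003, Prop. 6.18] [cite: PollackWeston2011MT, §3.1 and Thm. 4.1]
[cite: GreenbergVatsal2000, §2 Prop. (2.4) and §1 (9)] -/
theorem supNorm_depleted_eq_one_of_isPollackPair (hp2 : p ≠ 2) {N : ℕ} (f : CuspForm (Gamma0 N) 2)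
    {Lplus Lminus : IwasawaAlgebra p} (hPP : IsPollackPair f p Lplus Lminus) (ε : ℤˣ)
    (hunit : HasUnitContent (kobayashiL ε Lplus Lminus))
    (S₀ : Finset (HeightOneSpectrum (𝓞 ℚ))) (hS : ∀ v ∈ S₀, natGenerator v ≠ p) {n : ℕ}
    (hpar : Even n ↔ ε = 1)
    (hfrob : ∀ v ∈ S₀, (frobeniusExponent p (natGenerator v : ℤ_[p])).valuation < n)
    (hroom : (if ε = 1 then cyclotomicOmegaMinus p n else cyclotomicOmegaPlus p n).natDegree +
      lam (kobayashiL ε Lplus Lminus) + ∑ v ∈ S₀, delta W p v < p ^ n) :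
    (((mazurTateElement f p n).map (algebraMap ℚ (PadicAlgCl p)) *
          ∏ v ∈ S₀, ((W.localPolynomialAt v).map (Int.castRingHom (PadicAlgCl p))).comp
            (C ((natGenerator v : PadicAlgCl p)⁻¹) *
              (X + 1) ^ (PadicInt.toZModPow n (-(frobeniusExponent p (natGenerator v : ℤ_[p])))).val)) %ₘ
          ((X + 1) ^ p ^ n - 1)).supNorm = 1 ∧
      layerLambda (((mazurTateElement f p n).map (algebraMap ℚ (PadicAlgCl p)) *
          ∏ v ∈ S₀, ((W.localPolynomialAt v).map (Int.castRingHom (PadicAlgCl p))).comp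
            (C ((natGenerator v : PadicAlgCl p)⁻¹) *
              (X + 1) ^ (PadicInt.toZModPow n (-(frobeniusExponent p (natGenerator v : ℤ_[p])))).val)) %ₘ
          ((X + 1) ^ p ^ n - 1)) =
        (if ε = 1 then cyclotomicOmegaMinus p n else cyclotomicOmegaPlus p n).natDegree +
          lam (kobayashiL ε Lplus Lminus) + ∑ v ∈ S₀, delta W p v := by
  have hφ : ∀ x, ‖((algebraMap ℚ_[p] (PadicAlgCl p)).comp (algebraMap ℤ_[p] ℚ_[p])) x‖ = ‖x‖ :=
    norm_algebraMap_comp_padicInt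
  have hL0 : kobayashiL ε Lplus Lminus ≠ 0 := by
    rcases Int.units_eq_one_or ε with rfl | rfl
    · simpa [kobayashiL] using hPP.2.1
    · have : kobayashiL (-1) Lplus Lminus = Lplus := by simp [kobayashiL]
      rw [this]; exact hPP.1
  have hμ : mu (kobayashiL ε Lplus Lminus) = 0 := (hasUnitContent_iff_mu_eq_zero hL0).mp hunit
  rcases Int.units_eq_one_or ε with rfl | rfl
  · have heven : Even n := hpar.mpr rfl
    simp only [if_true, kobayashiL] at hroom hμ ⊢
    obtain ⟨R, hR, hordR⟩ := exists_integralModel_depleted_of_mu_eq_zero W hp2 f (map_zmod_cyclotomicOmegaMinus n)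
      (n / 2 + 1) hPP.2.1 hμ (hPP.2.2.2 n heven) S₀ hS hfrob hroom
    rw [hR]
    have h := layerLambda_map_eq_of_order _ hφ hordR
    exact ⟨h.2, h.1⟩
  · have hne : (-1 : ℤˣ) ≠ 1 := by decide
    have hodd : Odd n := Nat.not_even_iff_odd.mp fun h ↦ hne (hpar.mp h)
    simp only [hne, if_false, kobayashiL] at hroom hμ ⊢
    obtain ⟨R, hR, hordR⟩ := exists_integralModel_depleted_of_mu_eq_zero W hp2 f (map_zmod_cyclotomicOmegaPlus n)
      (n / 2 + 1) hPP.1 hμ (hPP.2.2.1 n hodd) S₀ hS hfrob hroom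
    rw [hR]
    have h := layerLambda_map_eq_of_order _ hφ hordR
    exact ⟨h.2, h.1⟩

/-- **Eventually `‖R_W‖_sup = 1`** (with the layer-`λ` formula), for a Pollack pair with `HasUnitContent (kobayashiL ε L⁺ L⁻)`:
`n₀ = Σ_{v∈S₀}(v_p(f_ℓ)+1) + 2(λ(L^ε)+Σδ) + 2` works. [cite: Pollack2003, Prop. 6.18] [cite: PollackWeston2011MT, Thm. 4.1] -/
theorem eventually_supNorm_depleted_eq_one_of_isPollackPair (hp2 : p ≠ 2) {N : ℕ} (f : CuspForm (Gamma0 N) 2)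
    {Lplus Lminus : IwasawaAlgebra p} (hPP : IsPollackPair f p Lplus Lminus) (ε : ℤˣ)
    (hunit : HasUnitContent (kobayashiL ε Lplus Lminus))
    (S₀ : Finset (HeightOneSpectrum (𝓞 ℚ))) (hS : ∀ v ∈ S₀, natGenerator v ≠ p) :
    ∃ n₀ : ℕ, ∀ n ≥ n₀, (Even n ↔ ε = 1) →
      (((mazurTateElement f p n).map (algebraMap ℚ (PadicAlgCl p)) *
            ∏ v ∈ S₀, ((W.localPolynomialAt v).map (Int.castRingHom (PadicAlgCl p))).comp
              (C ((natGenerator v : PadicAlgCl p)⁻¹) *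
                (X + 1) ^ (PadicInt.toZModPow n (-(frobeniusExponent p (natGenerator v : ℤ_[p])))).val)) %ₘ
            ((X + 1) ^ p ^ n - 1)).supNorm = 1 ∧
        layerLambda (((mazurTateElement f p n).map (algebraMap ℚ (PadicAlgCl p)) *
            ∏ v ∈ S₀, ((W.localPolynomialAt v).map (Int.castRingHom (PadicAlgCl p))).comp
              (C ((natGenerator v : PadicAlgCl p)⁻¹) *
                (X + 1) ^ (PadicInt.toZModPow n (-(frobeniusExponent p (natGenerator v : ℤ_[p])))).val)) %ₘ
            ((X + 1) ^ p ^ n - 1)) =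
          (if ε = 1 then cyclotomicOmegaMinus p n else cyclotomicOmegaPlus p n).natDegree +
            lam (kobayashiL ε Lplus Lminus) + ∑ v ∈ S₀, delta W p v := by
  set t : HeightOneSpectrum (𝓞 ℚ) → ℕ := fun v ↦ (frobeniusExponent p (natGenerator v : ℤ_[p])).valuation with ht
  set B : ℕ := lam (kobayashiL ε Lplus Lminus) + ∑ v ∈ S₀, delta W p v with hB
  refine ⟨(∑ v ∈ S₀, (t v + 1)) + (2 * B + 2), fun n hn hpar ↦ ?_⟩
  have htn : ∀ v ∈ S₀, t v < n := fun v hv ↦ by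
    have := Finset.single_le_sum (f := fun w ↦ t w + 1) (fun _ _ ↦ Nat.zero_le _) hv
    omega
  have hroom := natDegree_omega_add_lt_pow (p := p) (B := B) (n := n) (by omega) ε
  exact supNorm_depleted_eq_one_of_isPollackPair W hp2 f hPP ε hunit S₀ hS hpar htn (by rw [hB] at hroom; omega)

end Pollack

end Summit.BirchSwinnertonDyer.BirchSwinnertonDyer.Theorems.SmallImageRttKan

end
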